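import Summits.QuantumFields.YangMills.Theorems.FluctuationComparisonRegPrIntLS1aDomBGOfOneStepLetters
import Literature.MathematicalPhysics.QuantumFieldTheory.Balaban1983to89.B10LargeFieldSum
import HarnessLib

/-!
# S1a · PRINT's (7)→(41) ON THE LINE's CUT TOWER: THE DECOMPOSITION OF UNITY INTO LARGE-FIELD HISTORIES, BY KERNEL, AND THE CUT-HEIGHT DOMINATION LETTER
# `hdomBG_j` FROM PER-HISTORY RELATIVE LETTERS (the SECOND road to `hdomBG_j`; the first is ✓`…S1aDomBGOfOneStepLetters`)

Cell `ym3-torus` (YM ladder rung R3 = continuum `SU(2)` Yang–Mills on the three-torus — a RUNG: NOT d = 4, NOT infinite volume, NOT a mass gap, NOT Clay).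
Width seat «width 8» `ym3-torus-px8` (gen 27), FREE px helper on crux `stmt-QuantumFields-20520`, count-neutral, DEFINITION-FREE, default heartbeats.  FILE 1 of the seat
(lineage: doors of record ✓p828515 ∕ ✓p830144 → ᴱ-editions ✓p830750 ∕ ✓p831092 ∕ ✓p831345 (g25) → the one-step road ✓p832521 ∕ ✓p832934 ∕ ✓p833125 ∕ ✓p833619 ∕ ✓p833698 (g26)).

WHY.  The (m)_E node's one unprinted letter is `hdomBG_j` (✓p831345 `…S1aAlphaPhiMTowerBG` l.86–90): at every (E)-good datum `V` of height `j` the RUN density is at most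
`e^{Δ_j}` times the CUT-TOWER density.  ✓p832521 reduced it to ONE-STEP CONDITIONAL PLATEAU LETTERS `(L_i)`, each conditioned on an ARBITRARY measurable event `A ⊆ D_i` at the
intermediate height `i` (equivalently: a.e.-pointwise in the intermediate datum — ✓p832934 ∕ ✓p833698).  That is a currency print never uses.  Print's own road ([Balaban1985UV3]):
the decomposition of unity (7) p.257 `1 = Π_p (χ_p + (1 − χ_p))`, inserted at every renormalization step and «partially resummed» (p.258 (8)), turns `ρ_k(V)` into the SUM (41)
p.266 over LARGE-FIELD HISTORIES `{Ω_j}` of fibre integrals above the SAME bottom datum `V`; every history carries the small factor `e^{−¼p²(g_j)}` per large plaquette ((67)–(71)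
p.273) against the volume terms `O(log g_j⁻¹)|Z_j|`, and «the analysis of Sect. 3.C [9], which is model independent, show[s] that these small factors are enough to control all sums
in (41)» (pp.273–274) — the resummation `Σ_{Q⊆E} Π_{e∈Q} w_e = Π_E (1 + w_e) ≤ e^{Σ w_e}` kernel-proved in lit ✓`B10LargeFieldSum.sum_powerset_prod_le_exp`.  THIS FILE puts
print's road on the line's objects, by kernel: the line's tower is cut by `sfCut θ = Π_p χ_p` (`RunPairOrgan.sfCut` :70 — literally (7)'s product shape), the all-small-field
term of the expansion IS the cut tower's mass, and `hdomBG_j` follows from ONE RELATIVE LETTER PER LARGE-FIELD HISTORY, conditioned on the bottom datum only.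

WHAT (0 `def`, 0 `sorry`; the cut weights abstract — any measurable `χ_i`, read on run `K` as `w i = χ_{i+1} ∘ descendTo_{i+1}`; the line's `ofReal ∘ sfCut` is the instance).
§0 (any measure space, any finite family of measurable weights `g_i ≤ 1`, `I : Finset ℕ`):
   `sum_powerset_prod_tsub_mul_prod_eq_one` — (7) pointwise: `Σ_{S⊆I} Π_S (1 − a)·Π_{I∖S} a = 1` (`Finset.prod_add` in `ℝ≥0∞`) ·
   ★★`measure_eq_sum_powerset_lintegral` — THE HISTORY EXPANSION `G(T) = Σ_{S⊆I} ∫⁻_T Π_{i∈S}(1 − g_i)·Π_{i∈I∖S} g_i dG` ((7) ⟹ (41) at measure level) ·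
   ★★`measure_le_exp_mul_lintegral_prod_of_historyLetters` — THE RESUMMATION DOOR: relative letters «`∫⁻_T Π_S(1−g)Π_{I∖S}g ≤ (Π_{i∈S} ω_i)·∫⁻_T Π_I g`, `S ≠ ∅`» ⟹
   `G(T) ≤ e^{Σ_I ω}·∫⁻_T Π_I g` · `one_tsub_prod_le_sum_one_tsub` — inside one height `1 − Π_p c_p ≤ Σ_p (1 − c_p)` (per-plaquette organisation of a large factor).
§1 ★★`tower_eq_map_withDensity_prod` — THE EXACT PRODUCT FORM OF THE CUT TOWER `μ j = (descendTo_j)_*(Gibbs_K · Π_{i∈[j,Ts)} w i)` (the identity half of px21's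
   ✓`…S1aTowerLawSandwich.map_restrict_le_tower`; ✓`map_withDensity_comp_eq`, `withDensity_mul`, lit ✓`descendTo_descendTo`); ★`tower_apply_eq_lintegral_prod` — its mass form.
§2 ★★★`run_le_exp_mul_cutTower_of_historyLetters` — AT THE T³ RUNS: per-history relative letters for the cut steps `[j, Ts)` above every measurable `A ⊆ D_j` ⟹
   `ν K j (A) ≤ e^{Σ_{i∈[j,Ts)} ω_i}·μ j (A)`; ★★`density_ae_le_on_domain_of_historyLetters` ∕ ★★`density_le_on_open_of_historyLetters` (✓p832521 §2's pipeline);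
   ★★★`hdomBG_of_historyLetters` — the `hdomBG_j` binder of ✓p831345 VERBATIM (`θ := θBal F.L γ b₀ p₀ j`, `Δ := Δ j`; same text as ✓`hdomBG_of_oneStepLetters`).
§3 `canonicalWeight_spec` — the canonical reading `w i := ofReal (χ_{i+1} ∘ descendTo_{i+1})` (`i + 1 ≤ K`, else `1`) meets §2's three side conditions; the budget
   `ω_i ≤ c·q^i ⟹ Σ_{[j,Ts)} ω ≤ (c∕(1−q))·q^j` is ✓`…S1aDomBGOfOneStepLetters.sum_Ico_le_geom` (uniform in `Ts`; ✓`admissible_add_slack`'s input).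

THE LETTER, AND ★p1's LOCATED INPUTS (UV3-NODE §69.20; nothing asserted).  For a nonempty set `S ⊆ [j, Ts)` of cut steps and a measurable `A ⊆ D_j`:
«`Gibbs_K[1_{Ū_j∈A} · Π_{i∈S}(1 − χ_{i+1}(Ū_{i+1})) · Π_{i∈[j,Ts)∖S} χ_{i+1}(Ū_{i+1})] ≤ (Π_{i∈S} ω_i) · Gibbs_K[1_{Ū_j∈A} · Π_{i∈[j,Ts)} χ_{i+1}(Ū_{i+1})]`» — the history LARGE at
exactly the cut heights of `S` costs `Π ω` RELATIVE TO THE ALL-SMALL HISTORY above the same data.  Print supplies, per history: (a) the small factor `e^{−¼p²(g_i)}` per large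
plaquette = (67)–(71) (kernel for print's concrete average on the torus: lit ✓`B10Eq71TorusLocal` ∕ ✓`B10Eq69TorusPullback`; for `ℰp` the (53)-type input is lit
✓`BlockAveragingEMLProp2`); (b) VARIATIONAL MONOTONICITY — the all-small history's minimiser has the least action among all histories over `V` ((42) p.266; ✓p833125's nesting is
the order-theoretic half); (c) the RELATIVE cost of a history against the all-small one, `e^{O(log g_i⁻¹)|Z_i|}` in (41), which print states only ABSOLUTELY — relative to the
all-small term it is the LOCALITY of the difference of the two effective actions (polymer sums (43)–(46) under a change of background confined near `Z_i`: minimiser stability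
[Balaban1985Variational] + [9] Sect. 3.C) — NOT a printed sentence; (d) the resummation — kernel (§0).  HONEST: measure-theoretic bookkeeping over landed kernel facts; every `ω_i`
is a HYPOTHESIS; `hdomBG_j` REDUCED (second road), NOT discharged; nothing of Bałaban's renormalisation-group analysis asserted or proved; (α) package UNINHABITED; (m) AS TYPED
suspect-false@L=3 (RULING №105), (m)_E OPEN; the five registered stubs (3732b7df UNTOUCHED, 0∕5) ∕ 20520 ∕ 19936 ∕ 19200 ∕ `YM3TorusSU2` NOT proved; rung R3 = SU(2) YM₃ on T³ at
fixed lattice data — NOT d = 4, NOT infinite volume, NOT a mass gap, NOT Clay.  Sorry-free, axioms standard.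
References: [Balaban1985UV3] CMP 102 (1985) (7) p.257, (8) p.258, (41)–(42) p.266, (47) p.267, (67)–(71) pp.273–274; [Balaban1987RG1] CMP 109 (1987) (0.11) p.253.
-/

set_option autoImplicit false

noncomputable section

namespace Summit.QuantumFields.YangMills.Theorems.FluctuationComparisonRegPrIntLS1aDomBGOfHistoryLetters

open MeasureTheory Filter Topology Set Function
open scoped ENNReal NNReal
open Literature.MathematicalPhysics.QuantumFieldTheory.Balaban1983to89
open T3ContinuumYM3Torus T3NestedUnitLaws T3UnitLawDensityEML T3UnitScaleTilt T3LevelShift T3TiltDescent T4Continuum BalabanUVClass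
open Literature.MathematicalPhysics.QuantumFieldTheory.Balaban1983to89.Missing
open Literature.MathematicalPhysics.QuantumFieldTheory.Balaban1983to89.T3DescentFibreTower (descendTo_descendTo descendTo_self)
open scoped Literature.MathematicalPhysics.QuantumFieldTheory.Balaban1983to89.T3OrbitAverage
open Summit.QuantumFields.YangMills.Theorems.FluctuationComparisonRegPrIntLOrganTangentFibredChartDescendTo (descend_eq_descendTo')
open Summit.QuantumFields.YangMills.Theorems.FluctuationComparisonRegPrIntLS1aTowerLawSandwich
  (run_eq_map_descendTo map_withDensity_comp_eq)
open Summit.QuantumFields.YangMills.Theorems.FluctuationComparisonRegPrIntLS1aDomBGOfOneStepLetters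
  (withDensity_restrict_le_of_forall_le ae_restrict_le_of_withDensity_restrict_le)
open Summit.QuantumFields.YangMills.Theorems.FluctuationComparisonRegPrIntLS1aInvariantVersion (le_on_of_ae_le_of_continuousOn)
open Literature.MathematicalPhysics.QuantumFieldTheory.Balaban1983to89.B10LargeFieldSum (sum_powerset_prod_le_exp)

/-! ## §0 The decomposition of unity and the resummation, for any finite family of weights `g_i ≤ 1` on any measure space -/

section Abstract

variable {X : Type*} [MeasurableSpace X]

/-- **(7) POINTWISE**: for finitely many weights `a_i ≤ 1` in `ℝ≥0∞`, `Σ_{S ⊆ I} (Π_{i∈S} (1 − a_i)) · (Π_{i∈I∖S} a_i) = 1` — the decomposition of unity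
`1 = Π_i ((1 − a_i) + a_i)` expanded over the «large» index sets `S` (`Finset.prod_add`). [cite: Balaban1985UV3, (7) p.257] -/
theorem sum_powerset_prod_tsub_mul_prod_eq_one (I : Finset ℕ) {a : ℕ → ℝ≥0∞} (ha : ∀ i ∈ I, a i ≤ 1) :
    ∑ S ∈ I.powerset, (∏ i ∈ S, (1 - a i)) * (∏ i ∈ I \ S, a i) = 1 := by
  rw [← Finset.prod_add]
  exact Finset.prod_eq_one fun i hi => tsub_add_cancel_of_le (ha i hi)

/-- **(7) AT MEASURE LEVEL — THE HISTORY EXPANSION**: for finitely many measurable weights `g_i ≤ 1` on a measure space and any measurable `T`,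
`G(T) = Σ_{S ⊆ I} ∫⁻_T (Π_{i∈S} (1 − g_i)) · (Π_{i∈I∖S} g_i) dG` — the mass is the sum over the LARGE-INDEX SETS `S` of the masses «large exactly on `S`,
weighted small elsewhere»; the `S = ∅` term is `∫⁻_T Π_I g_i dG`. [cite: Balaban1985UV3, (7) p.257 and (41) p.266] -/
theorem measure_eq_sum_powerset_lintegral (G : Measure X) (I : Finset ℕ) {g : ℕ → X → ℝ≥0∞} (hgm : ∀ i, Measurable (g i))
    (hg1 : ∀ i x, g i x ≤ 1) (T : Set X) :
    G T = ∑ S ∈ I.powerset, ∫⁻ x in T, (∏ i ∈ S, (1 - g i x)) * (∏ i ∈ I \ S, g i x) ∂G := by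
  have hmeas : ∀ S ∈ I.powerset, Measurable fun x => (∏ i ∈ S, (1 - g i x)) * (∏ i ∈ I \ S, g i x) := fun S _ =>
    (Finset.measurable_prod S fun i _ => measurable_const.sub (hgm i)).mul (Finset.measurable_prod _ fun i _ => hgm i)
  rw [← lintegral_finsetSum _ hmeas]
  have h1 : ∀ x, ∑ S ∈ I.powerset, (∏ i ∈ S, (1 - g i x)) * (∏ i ∈ I \ S, g i x) = 1 := fun x =>
    sum_powerset_prod_tsub_mul_prod_eq_one I fun i _ => hg1 i x
  simp_rw [h1]
  rw [lintegral_one, Measure.restrict_apply_univ]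

/-- ★★ **THE RESUMMATION DOOR** («the analysis of Sect. 3.C [9] … show[s] that these small factors are enough to control all sums in (41)», p.273): if every NONEMPTY
large-index set `S ⊆ I` satisfies the RELATIVE letter `∫⁻_T Π_{S}(1 − g)·Π_{I∖S} g dG ≤ (Π_{i∈S} ω_i) · ∫⁻_T Π_I g dG` with `ω ≥ 0`, then
`G(T) ≤ e^{Σ_{i∈I} ω_i} · ∫⁻_T Π_I g dG` (history expansion + `Σ_{S⊆I} Π_S ω = Π_I (1 + ω) ≤ e^{Σ ω}`, lit ✓`B10LargeFieldSum.sum_powerset_prod_le_exp`).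
[cite: Balaban1985UV3, (41) p.266 and pp.273–274] -/
theorem measure_le_exp_mul_lintegral_prod_of_historyLetters (G : Measure X) (I : Finset ℕ) {g : ℕ → X → ℝ≥0∞}
    (hgm : ∀ i, Measurable (g i)) (hg1 : ∀ i x, g i x ≤ 1) (T : Set X) {ω : ℕ → ℝ} (hω : ∀ i, 0 ≤ ω i)
    (hhist : ∀ S ∈ I.powerset, S.Nonempty →
      ∫⁻ x in T, (∏ i ∈ S, (1 - g i x)) * (∏ i ∈ I \ S, g i x) ∂G ≤ ENNReal.ofReal (∏ i ∈ S, ω i) * ∫⁻ x in T, ∏ i ∈ I, g i x ∂G) :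
    G T ≤ ENNReal.ofReal (Real.exp (∑ i ∈ I, ω i)) * ∫⁻ x in T, ∏ i ∈ I, g i x ∂G := by
  rw [measure_eq_sum_powerset_lintegral G I hgm hg1 T]
  -- every term, the empty history included, is bounded by its product of letters times the all-small mass
  have hall : ∀ S ∈ I.powerset,
      ∫⁻ x in T, (∏ i ∈ S, (1 - g i x)) * (∏ i ∈ I \ S, g i x) ∂G ≤ ENNReal.ofReal (∏ i ∈ S, ω i) * ∫⁻ x in T, ∏ i ∈ I, g i x ∂G := by
    intro S hS
    rcases S.eq_empty_or_nonempty with h | h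
    · subst h
      simp
    · exact hhist S hS h
  refine (Finset.sum_le_sum hall).trans ?_
  rw [← Finset.sum_mul, ← ENNReal.ofReal_sum_of_nonneg fun S _ => Finset.prod_nonneg fun i _ => hω i]
  gcongr
  exact sum_powerset_prod_le_exp I ω fun i _ => hω i

/-- **THE PER-PLAQUETTE SPLIT OF ONE LARGE FACTOR**: for finitely many `[0,1]`-valued factors, `1 − Π_p c_p ≤ Σ_p (1 − c_p)` (in `ℝ≥0∞`) — inside one height the
large factor `1 − χ_i` of a history is at most the SUM over the plaquettes of the per-plaquette large factors (the line's `sfCut` is such a product), so a per-history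
letter may be supplied plaquette by plaquette, as print does ((7): `χ_k = Π_p χ(p)`). [cite: Balaban1985UV3, (7) p.257] -/
theorem one_tsub_prod_le_sum_one_tsub {ι : Type*} (s : Finset ι) {c : ι → ℝ≥0∞} (hc : ∀ p ∈ s, c p ≤ 1) :
    1 - ∏ p ∈ s, c p ≤ ∑ p ∈ s, (1 - c p) := by
  classical
  induction s using Finset.induction_on with
  | empty => simp
  | insert a s has ih =>
    rw [Finset.prod_insert has, Finset.sum_insert has]
    have ha : c a ≤ 1 := hc a (Finset.mem_insert_self a s)
    have hs : ∀ p ∈ s, c p ≤ 1 := fun p hp => hc p (Finset.mem_insert_of_mem hp)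
    have hP : ∏ p ∈ s, c p ≤ 1 := Finset.prod_le_one' fun p hp => hs p hp
    -- `1 − a·P ≤ (1 − a) + (1 − P)` for `a, P ≤ 1`
    calc 1 - c a * ∏ p ∈ s, c p ≤ (1 - c a) + (1 - ∏ p ∈ s, c p) := by
          have hne : c a ≠ ∞ := ne_top_of_le_ne_top ENNReal.one_ne_top ha
          have hPne : ∏ p ∈ s, c p ≠ ∞ := ne_top_of_le_ne_top ENNReal.one_ne_top hP
          rw [tsub_le_iff_right]
          calc (1 : ℝ≥0∞) = (1 - c a) + c a := (tsub_add_cancel_of_le ha).symm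
            _ = (1 - c a) + c a * 1 := by rw [mul_one]
            _ = (1 - c a) + c a * ((1 - ∏ p ∈ s, c p) + ∏ p ∈ s, c p) := by rw [tsub_add_cancel_of_le hP]
            _ = (1 - c a) + (c a * (1 - ∏ p ∈ s, c p) + c a * ∏ p ∈ s, c p) := by rw [mul_add]
            _ ≤ (1 - c a) + (1 * (1 - ∏ p ∈ s, c p) + c a * ∏ p ∈ s, c p) := by gcongr
            _ = (1 - c a) + (1 - ∏ p ∈ s, c p) + c a * ∏ p ∈ s, c p := by rw [one_mul, add_assoc]
      _ ≤ (1 - c a) + ∑ p ∈ s, (1 - c p) := add_le_add le_rfl (ih hs)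

end Abstract

/-! ## §1 The exact product form of the cut tower: `μ j = (descendTo_j)_*(Gibbs_K · Π_{i∈[j,Ts)} χ_{i+1}∘descendTo_{i+1})` -/

section Tower

variable (F : T3Family) {γ : ℝ}
  (χ : (i : ℕ) → GaugeField (F.P i) 0 ↥(Matrix.specialUnitaryGroup (Fin 2) ℂ) → ℝ≥0∞)
  (ν : ℕ → (j : ℕ) → Measure (GaugeField (F.P j) 0 ↥(Matrix.specialUnitaryGroup (Fin 2) ℂ)))
  {K Ts : ℕ}
  (μ : (j : ℕ) → Measure (GaugeField (F.P j) 0 ↥(Matrix.specialUnitaryGroup (Fin 2) ℂ)))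
  -- the cut weights READ ON RUN `K`'s finest field: any family `w` agreeing with `χ_{i+1} ∘ descendTo_{i+1}` for the cut steps `i ∈ [j, Ts)`
  (w : ℕ → GaugeField (F.P K) 0 ↥(Matrix.specialUnitaryGroup (Fin 2) ℂ) → ℝ≥0∞)

/-- ★★ **THE EXACT PRODUCT FORM OF THE CUT TOWER.**  For S1aᴴ's run system `ν` (`ν K K = Gibbs_K`, `ν K j = (descend j)_* ν K (j+1)`) and ANY tower `μ` equal to `ν K`
from `Ts ≤ K` up and cut below `Ts` by measurable weights `χ` (`μ j = (descend j)_*((μ (j+1))·χ_{j+1})`), and any measurable family `w` on run `K`'s finest fields with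
`w i = χ_{i+1} ∘ descendTo_{i+1}` for `j₀ ≤ i < Ts`: for every `j₀ ≤ j ≤ K`, **`μ j = (descendTo F ℰp j K)_*(Gibbs_K · Π_{i∈[j,Ts)} w i)`** — the cut tower's law at height
`j` IS the descended Gibbs measure weighted by the product of all cut weights met on the way down (the identity half of px21's ✓`map_restrict_le_tower`; downward induction:
✓`map_withDensity_comp_eq`, `withDensity_mul`, ✓`descend ∘ descendTo = descendTo`). [cite: Balaban1985UV3, (7) p.257 and (41) p.266; Balaban1987RG1, (0.11) p.253] -/
theorem tower_eq_map_withDensity_prod (hχm : ∀ i, Measurable (χ i))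
    (hν1 : ∀ K, ν K K = T4GenFunBounds.gibbsMeasure (F.P K) ((F.scheme ℰp γ).β K))
    (hν2 : ∀ K j, j < K → ν K j = Measure.map (descend F ℰp j) (ν K (j + 1)))
    (hTs : Ts ≤ K)
    (hanch : ∀ j, Ts ≤ j → μ j = ν K j)
    (hcut : ∀ j, j < Ts → μ j = Measure.map (descend F ℰp j) ((μ (j + 1)).withDensity (χ (j + 1))))
    (hwm : ∀ i, Measurable (w i)) {j₀ : ℕ}
    (hw : ∀ (i : ℕ), j₀ ≤ i → ∀ (hiT : i < Ts), ∀ U, w i U = χ (i + 1) (descendTo F ℰp (i + 1) K (Nat.succ_le_of_lt (lt_of_lt_of_le hiT hTs)) U))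
    {j : ℕ} (hj₀ : j₀ ≤ j) (hjK : j ≤ K) :
    μ j = Measure.map (descendTo F ℰp j K hjK) ((gibbsK F ℰp γ K).withDensity fun U => ∏ i ∈ Finset.Ico j Ts, w i U) := by
  -- at and above the seed height the product is empty
  have htop : ∀ (j : ℕ) (hjK : j ≤ K), Ts ≤ j →
      μ j = Measure.map (descendTo F ℰp j K hjK) ((gibbsK F ℰp γ K).withDensity fun U => ∏ i ∈ Finset.Ico j Ts, w i U) := by
    intro j hjK hj
    have e : (fun U : GaugeField (F.P K) 0 ↥(Matrix.specialUnitaryGroup (Fin 2) ℂ) => ∏ i ∈ Finset.Ico j Ts, w i U) = 1 := by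
      funext U
      rw [Finset.Ico_eq_empty (by omega), Finset.prod_empty]
      rfl
    rw [e, withDensity_one, hanch j hj, run_eq_map_descendTo F ν hν1 hν2 hjK]
  -- below it: downward induction on `n = Ts − j`
  suffices h : ∀ (n j : ℕ) (hjK : j ≤ K), j₀ ≤ j → j + n = Ts →
      μ j = Measure.map (descendTo F ℰp j K hjK) ((gibbsK F ℰp γ K).withDensity fun U => ∏ i ∈ Finset.Ico j Ts, w i U) by
    rcases le_or_gt Ts j with hj | hj
    · exact htop j hjK hj
    · exact h (Ts - j) j hjK hj₀ (by omega)
  intro n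
  induction n with
  | zero =>
    intro j hjK _ hj
    rw [add_zero] at hj
    exact htop j hjK hj.ge
  | succ n ih =>
    intro j hjK hj₀j hj
    have hjT : j < Ts := by omega
    have hjK' : j + 1 ≤ K := by omega
    have hd : Measurable (descend F ℰp j : GaugeField (F.P (j + 1)) 0 ↥(Matrix.specialUnitaryGroup (Fin 2) ℂ) →
        GaugeField (F.P j) 0 ↥(Matrix.specialUnitaryGroup (Fin 2) ℂ)) := measurable_descend F ℰp measurableE_ℰp j
    have hD : Measurable (descendTo F ℰp (j + 1) K hjK' : GaugeField (F.P K) 0 ↥(Matrix.specialUnitaryGroup (Fin 2) ℂ) →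
        GaugeField (F.P (j + 1)) 0 ↥(Matrix.specialUnitaryGroup (Fin 2) ℂ)) := measurable_descendTo F ℰp measurableE_ℰp hjK'
    have hIH := ih (j + 1) hjK' (by omega) (by omega)
    have hPm : Measurable fun U : GaugeField (F.P K) 0 ↥(Matrix.specialUnitaryGroup (Fin 2) ℂ) => ∏ i ∈ Finset.Ico (j + 1) Ts, w i U :=
      Finset.measurable_prod _ fun i _ => hwm i
    -- `descend j ∘ descendTo (j+1) K = descendTo j K`
    have e : (descendTo F ℰp j K hjK : GaugeField (F.P K) 0 ↥(Matrix.specialUnitaryGroup (Fin 2) ℂ) →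
        GaugeField (F.P j) 0 ↥(Matrix.specialUnitaryGroup (Fin 2) ℂ)) = descend F ℰp j ∘ descendTo F ℰp (j + 1) K hjK' := by
      funext U
      show descendTo F ℰp j K hjK U = descend F ℰp j (descendTo F ℰp (j + 1) K hjK' U)
      rw [descend_eq_descendTo' F j (Nat.le_succ j), descendTo_descendTo]
    -- the bottom weight splits off the product
    have eprod : (fun U : GaugeField (F.P K) 0 ↥(Matrix.specialUnitaryGroup (Fin 2) ℂ) => ∏ i ∈ Finset.Ico j Ts, w i U) =
        (fun U => ∏ i ∈ Finset.Ico (j + 1) Ts, w i U) * fun U => χ (j + 1) (descendTo F ℰp (j + 1) K hjK' U) := by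
      funext U
      rw [Pi.mul_apply, Finset.prod_eq_prod_Ico_succ_bot hjT, hw j hj₀j hjT U, mul_comm]
    have hgm : Measurable fun U : GaugeField (F.P K) 0 ↥(Matrix.specialUnitaryGroup (Fin 2) ℂ) => χ (j + 1) (descendTo F ℰp (j + 1) K hjK' U) :=
      (hχm (j + 1)).comp hD
    rw [hcut j hjT, hIH, ← map_withDensity_comp_eq hD (hχm (j + 1)), ← withDensity_mul _ hPm hgm, ← eprod,
      Measure.map_map hd hD, ← e]

/-- ★ **THE CUT TOWER's MASS AS ONE GIBBS INTEGRAL**: under the same hypotheses, for every measurable `A` at height `j`,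
`μ j (A) = ∫⁻_{descendTo_j⁻¹ A} Π_{i∈[j,Ts)} w i dGibbs_K`. [cite: Balaban1985UV3, (41) p.266] -/
theorem tower_apply_eq_lintegral_prod (hχm : ∀ i, Measurable (χ i))
    (hν1 : ∀ K, ν K K = T4GenFunBounds.gibbsMeasure (F.P K) ((F.scheme ℰp γ).β K))
    (hν2 : ∀ K j, j < K → ν K j = Measure.map (descend F ℰp j) (ν K (j + 1)))
    (hTs : Ts ≤ K)
    (hanch : ∀ j, Ts ≤ j → μ j = ν K j)
    (hcut : ∀ j, j < Ts → μ j = Measure.map (descend F ℰp j) ((μ (j + 1)).withDensity (χ (j + 1))))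
    (hwm : ∀ i, Measurable (w i)) {j₀ : ℕ}
    (hw : ∀ (i : ℕ), j₀ ≤ i → ∀ (hiT : i < Ts), ∀ U, w i U = χ (i + 1) (descendTo F ℰp (i + 1) K (Nat.succ_le_of_lt (lt_of_lt_of_le hiT hTs)) U))
    {j : ℕ} (hj₀ : j₀ ≤ j) (hjK : j ≤ K)
    {A : Set (GaugeField (F.P j) 0 ↥(Matrix.specialUnitaryGroup (Fin 2) ℂ))} (hA : MeasurableSet A) :
    μ j A = ∫⁻ U in descendTo F ℰp j K hjK ⁻¹' A, ∏ i ∈ Finset.Ico j Ts, w i U ∂(gibbsK F ℰp γ K) := by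
  have hD : Measurable (descendTo F ℰp j K hjK : GaugeField (F.P K) 0 ↥(Matrix.specialUnitaryGroup (Fin 2) ℂ) →
      GaugeField (F.P j) 0 ↥(Matrix.specialUnitaryGroup (Fin 2) ℂ)) := measurable_descendTo F ℰp measurableE_ℰp hjK
  rw [tower_eq_map_withDensity_prod F χ ν μ w hχm hν1 hν2 hTs hanch hcut hwm hw hj₀ hjK, Measure.map_apply hD hA,
    withDensity_apply _ (hA.preimage hD)]

end Tower

/-! ## §2 The history road at the T³ runs: `ν K j (A) ≤ e^{Σ_{i∈[j,Ts)} ω_i} · μ j (A)` from per-history relative letters, and the `hdomBG_j` binder -/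

section History

variable (F : T3Family) {γ : ℝ}
  (ν : ℕ → (j : ℕ) → Measure (GaugeField (F.P j) 0 ↥(Matrix.specialUnitaryGroup (Fin 2) ℂ)))
  {K Ts : ℕ}
  (μ : (j : ℕ) → Measure (GaugeField (F.P j) 0 ↥(Matrix.specialUnitaryGroup (Fin 2) ℂ)))
  (χ : (i : ℕ) → GaugeField (F.P i) 0 ↥(Matrix.specialUnitaryGroup (Fin 2) ℂ) → ℝ)
  (w : ℕ → GaugeField (F.P K) 0 ↥(Matrix.specialUnitaryGroup (Fin 2) ℂ) → ℝ≥0∞)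
  (D : (i : ℕ) → Set (GaugeField (F.P i) 0 ↥(Matrix.specialUnitaryGroup (Fin 2) ℂ)))
  -- S1aᴴ's run system and a cut tower with MEASURABLE real weights `χ` (the line's `sfCut`: ✓`RunPairOrgan.measurable_sfCut`; `χ ≤ 1` enters only through `w ≤ 1`)
  (hν1 : ∀ K, ν K K = T4GenFunBounds.gibbsMeasure (F.P K) ((F.scheme ℰp γ).β K))
  (hν2 : ∀ K j, j < K → ν K j = Measure.map (descend F ℰp j) (ν K (j + 1)))
  (hTs : Ts ≤ K) (hχm : ∀ i, Measurable (χ i))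
  (hanch : ∀ j, Ts ≤ j → μ j = ν K j)
  (hcut : ∀ j, j < Ts → μ j = Measure.map (descend F ℰp j) ((μ (j + 1)).withDensity fun U => ENNReal.ofReal (χ (j + 1) U)))
  -- the cut weights read on run `K` (any measurable family `w ≤ 1` agreeing with `ofReal ∘ χ_{i+1} ∘ descendTo_{i+1}` on the cut steps `[j, Ts)`)
  {j : ℕ} (hjK : j ≤ K) (hwm : ∀ i, Measurable (w i)) (hw1 : ∀ i U, w i U ≤ 1)
  (hw : ∀ (i : ℕ), j ≤ i → ∀ (hiT : i < Ts), ∀ U,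
    w i U = ENNReal.ofReal (χ (i + 1) (descendTo F ℰp (i + 1) K (Nat.succ_le_of_lt (lt_of_lt_of_le hiT hTs)) U)))
  -- the PER-HISTORY RELATIVE LETTERS above every measurable `A ⊆ D_j`: one letter per nonempty set `S ⊆ [j, Ts)` of large cut steps
  (ω : ℕ → ℝ) (hω : ∀ i, 0 ≤ ω i)
  (hhist : ∀ A : Set (GaugeField (F.P j) 0 ↥(Matrix.specialUnitaryGroup (Fin 2) ℂ)), MeasurableSet A → A ⊆ D j →
    ∀ S ∈ (Finset.Ico j Ts).powerset, S.Nonempty →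
      ∫⁻ U in descendTo F ℰp j K hjK ⁻¹' A, (∏ i ∈ S, (1 - w i U)) * (∏ i ∈ Finset.Ico j Ts \ S, w i U) ∂(gibbsK F ℰp γ K) ≤
        ENNReal.ofReal (∏ i ∈ S, ω i) * ∫⁻ U in descendTo F ℰp j K hjK ⁻¹' A, ∏ i ∈ Finset.Ico j Ts, w i U ∂(gibbsK F ℰp γ K))

include hν1 hν2 hTs hχm hanch hcut hjK hwm hw1 hw hω hhist

/-- ★★★ **THE HISTORY ROAD, TOWER VERSION.**  Run system `ν`; ANY tower `μ` equal to `ν K` from `Ts` up and cut below `Ts` by measurable real weights `χ ≤ 1`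
(`μ j = (descend j)_*((μ (j+1))·(ofReal ∘ χ_{j+1}))`); the cut weights read on run `K`'s finest field as `w i = ofReal ∘ χ_{i+1} ∘ descendTo_{i+1}` (`j ≤ i < Ts`);
a supplier's domain `D_j`; and ONE RELATIVE LETTER PER LARGE-FIELD HISTORY — for every nonempty set `S ⊆ [j, Ts)` of cut steps and every measurable `A ⊆ D_j`:
«the Gibbs mass above `A` of the fields LARGE at exactly the cut heights `i+1`, `i ∈ S` (factor `1 − w i`) and weighted small at the others (factor `w i`) is at most
`Π_{i∈S} ω_i` times the mass weighted small at ALL cut heights» — print's (41) read RELATIVE to its all-small-field term.  THEN for every measurable `A ⊆ D_j`: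
**`ν K j (A) ≤ e^{Σ_{i∈[j,Ts)} ω_i} · μ j (A)`** (§0 history expansion + resummation; §1 the all-small term IS `μ j (A)`).  Nothing of Bałaban's asserted; every `ω_i` is a
HYPOTHESIS. [cite: Balaban1985UV3, (7) p.257, (41) p.266, (47) p.267 and pp.273–274] -/
theorem run_le_exp_mul_cutTower_of_historyLetters
    {A : Set (GaugeField (F.P j) 0 ↥(Matrix.specialUnitaryGroup (Fin 2) ℂ))} (hA : MeasurableSet A) (hAD : A ⊆ D j) :
    ν K j A ≤ ENNReal.ofReal (Real.exp (∑ i ∈ Finset.Ico j Ts, ω i)) * μ j A := by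
  have hD : Measurable (descendTo F ℰp j K hjK : GaugeField (F.P K) 0 ↥(Matrix.specialUnitaryGroup (Fin 2) ℂ) →
      GaugeField (F.P j) 0 ↥(Matrix.specialUnitaryGroup (Fin 2) ℂ)) := measurable_descendTo F ℰp measurableE_ℰp hjK
  -- the run side IS the Gibbs mass of the preimage; the tower side IS the all-small Gibbs integral (§1)
  rw [run_eq_map_descendTo F ν hν1 hν2 hjK, Measure.map_apply hD hA,
    tower_apply_eq_lintegral_prod F (fun i U => ENNReal.ofReal (χ i U)) ν μ w (fun i => ENNReal.measurable_ofReal.comp (hχm i))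
      hν1 hν2 hTs hanch hcut hwm hw le_rfl hjK hA]
  exact measure_le_exp_mul_lintegral_prod_of_historyLetters (gibbsK F ℰp γ K) (Finset.Ico j Ts) hwm hw1 _ hω (hhist A hA hAD)

/-- ★★ **DENSITY FORM, A.E. ON THE DOMAIN**: with densities `ν K j = dU_j·(ofReal ∘ ρᵗ)` (`ρᵗ` measurable) and `μ j = dU_j·(ofReal ∘ ρᶜ)` (`ρᶜ ≥ 0`) and `D_j` measurable,
the per-history letters give `ρᵗ ≤ e^{Σ_{i∈[j,Ts)} ω_i} · ρᶜ` for `dU_j`-almost every `V ∈ D_j` (✓p832521 §2's pipeline). [cite: Balaban1985UV3, (41) p.266 and (47) p.267] -/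
theorem density_ae_le_on_domain_of_historyLetters (hDm : MeasurableSet (D j))
    {ρc ρt : GaugeField (F.P j) 0 ↥(Matrix.specialUnitaryGroup (Fin 2) ℂ) → ℝ} (htm : Measurable ρt) (hc0 : ∀ V, 0 ≤ ρc V)
    (hμc : μ j = (fieldMeasure (F.P j) 0 ↥(Matrix.specialUnitaryGroup (Fin 2) ℂ)).withDensity fun V => ENNReal.ofReal (ρc V))
    (hνt : ν K j = (fieldMeasure (F.P j) 0 ↥(Matrix.specialUnitaryGroup (Fin 2) ℂ)).withDensity fun V => ENNReal.ofReal (ρt V)) :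
    ∀ᵐ V ∂(fieldMeasure (F.P j) 0 ↥(Matrix.specialUnitaryGroup (Fin 2) ℂ)).restrict (D j), ρt V ≤ Real.exp (∑ i ∈ Finset.Ico j Ts, ω i) * ρc V :=
  ae_restrict_le_of_withDensity_restrict_le htm hc0 (Real.exp_nonneg _)
    (withDensity_restrict_le_of_forall_le hνt hμc hDm fun _ hA hAD =>
      run_le_exp_mul_cutTower_of_historyLetters F ν μ χ w D hν1 hν2 hTs hχm hanch hcut hjK hwm hw1 hw ω hω hhist hA hAD)

/-- ★★ **DENSITY FORM, EVERYWHERE ON OPEN SUBSETS**: on any open `O ⊆ D_j` (`D_j` measurable) on which both densities are continuous (`ρᶜ ≥ 0`), the domination holds AT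
EVERY POINT (product Haar charges open sets: ✓`le_on_of_ae_le_of_continuousOn`). [cite: Balaban1985UV3, (41) p.266 and (47) p.267] -/
theorem density_le_on_open_of_historyLetters (hDm : MeasurableSet (D j))
    {ρc ρt : GaugeField (F.P j) 0 ↥(Matrix.specialUnitaryGroup (Fin 2) ℂ) → ℝ} (htm : Measurable ρt) (hc0 : ∀ V, 0 ≤ ρc V)
    (hμc : μ j = (fieldMeasure (F.P j) 0 ↥(Matrix.specialUnitaryGroup (Fin 2) ℂ)).withDensity fun V => ENNReal.ofReal (ρc V))
    (hνt : ν K j = (fieldMeasure (F.P j) 0 ↥(Matrix.specialUnitaryGroup (Fin 2) ℂ)).withDensity fun V => ENNReal.ofReal (ρt V))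
    {O : Set (GaugeField (F.P j) 0 ↥(Matrix.specialUnitaryGroup (Fin 2) ℂ))} (hO : IsOpen O) (hOD : O ⊆ D j)
    (hcO : ContinuousOn ρc O) (htO : ContinuousOn ρt O) :
    ∀ V ∈ O, ρt V ≤ Real.exp (∑ i ∈ Finset.Ico j Ts, ω i) * ρc V := by
  haveI : BorelSpace (GaugeField (F.P j) 0 ↥(Matrix.specialUnitaryGroup (Fin 2) ℂ)) := T3OrbitAverage.instBorelSpaceGaugeField
  haveI : (fieldMeasure (F.P j) 0 ↥(Matrix.specialUnitaryGroup (Fin 2) ℂ)).IsOpenPosMeasure :=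
    B12ContinuousTransportInvariance.isOpenPosMeasure_fieldMeasure_SU 2 (F.P j) 0
  have hae := density_ae_le_on_domain_of_historyLetters F ν μ χ w D hν1 hν2 hTs hχm hanch hcut hjK hwm hw1 hw ω hω hhist hDm htm hc0 hμc hνt
  exact le_on_of_ae_le_of_continuousOn (μ := fieldMeasure (F.P j) 0 ↥(Matrix.specialUnitaryGroup (Fin 2) ℂ)) hO htO
    (continuousOn_const.mul hcO) (ae_restrict_of_ae_restrict_of_subset hOD hae)

/-- ★★★ **THE `hdomBG_j` BINDER OF THE TOWER DOOR OF RECORD (✓`…S1aAlphaPhiMTowerBG` l.86–90), FROM THE PER-HISTORY LETTERS.**  In the door's scope (run system, `K`,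
`Ts ≤ K`, a tower cut by real weights `χ ≤ 1` — here also MEASURABLE, as the line's `sfCut` is — a height `j ≤ K`, continuous densities `ρᶜ ≥ 0` of `μ j` and `ρᵗ` of `ν K j`):
if the supplier's domain `D_j` is OPEN and contains (read back through `fieldShift`) every datum of the `θ`-window admitting a regular minimiser in `{PlaqSmall R₀}` with fine
plaquettes `< θ·L^{−2(K−j)}` (the (E)-good data of v19 «BACKGROUND WINDOWS»), and the per-history letters hold with `Σ_{i∈[j,Ts)} ω_i ≤ Δ`, THEN
`readAtLevel ρᵗ V ≤ e^{Δ} · readAtLevel ρᶜ V` at every such datum: the letter `hdomBG_j` VERBATIM (`θ := θBal F.L γ b₀ p₀ j`, `Δ := Δ j`).  Nothing of Bałaban's asserted;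
the letters `ω_i`, the domain `D_j` and the inclusion `hgood` are the supplier's. [cite: Balaban1985UV3, (41) p.266 and (47) p.267] -/
theorem hdomBG_of_historyLetters (hDo : IsOpen (D j)) {Δ : ℝ} (hΔ : ∑ i ∈ Finset.Ico j Ts, ω i ≤ Δ)
    (ρc ρt : GaugeField (F.P j) 0 ↥(Matrix.specialUnitaryGroup (Fin 2) ℂ) → ℝ) (hcc : Continuous ρc) (htc : Continuous ρt) (hc0 : ∀ V, 0 ≤ ρc V)
    (hμc : μ j = (fieldMeasure (F.P j) 0 ↥(Matrix.specialUnitaryGroup (Fin 2) ℂ)).withDensity fun V => ENNReal.ofReal (ρc V))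
    (hνt : ν K j = (fieldMeasure (F.P j) 0 ↥(Matrix.specialUnitaryGroup (Fin 2) ℂ)).withDensity fun V => ENNReal.ofReal (ρt V))
    {θ R₀ : ℝ}
    (hgood : ∀ V : GaugeField (F.P K) (K - j) ↥(Matrix.specialUnitaryGroup (Fin 2) ℂ), PlaqSmall θ V →
      (∃ U₀ : GaugeField (F.P K) 0 ↥(Matrix.specialUnitaryGroup (Fin 2) ℂ),
          IsBackground (fun i => BlockAveraging.blockAvg (P := F.P K) (j := i) ℰp) {U | PlaqSmall R₀ U} (K - j) V U₀ ∧
          PlaqSmall (θ * ((F.L : ℝ)⁻¹) ^ (2 * (K - j))) U₀) →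
      fieldShift (heightShift_eq F hjK) V ∈ D j) :
    ∀ V : GaugeField (F.P K) (K - j) ↥(Matrix.specialUnitaryGroup (Fin 2) ℂ), PlaqSmall θ V →
      (∃ U₀ : GaugeField (F.P K) 0 ↥(Matrix.specialUnitaryGroup (Fin 2) ℂ),
          IsBackground (fun i => BlockAveraging.blockAvg (P := F.P K) (j := i) ℰp) {U | PlaqSmall R₀ U} (K - j) V U₀ ∧
          PlaqSmall (θ * ((F.L : ℝ)⁻¹) ^ (2 * (K - j))) U₀) →
      readAtLevel F hjK ρt V ≤ Real.exp Δ * readAtLevel F hjK ρc V := by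
  haveI : BorelSpace (GaugeField (F.P j) 0 ↥(Matrix.specialUnitaryGroup (Fin 2) ℂ)) := T3OrbitAverage.instBorelSpaceGaugeField
  have hpt := density_le_on_open_of_historyLetters F ν μ χ w D hν1 hν2 hTs hχm hanch hcut hjK hwm hw1 hw ω hω hhist hDo.measurableSet
    htc.measurable hc0 hμc hνt hDo subset_rfl hcc.continuousOn htc.continuousOn
  intro V hV hex
  rw [readAtLevel_apply, readAtLevel_apply]
  exact (hpt _ (hgood V hV hex)).trans (mul_le_mul_of_nonneg_right (Real.exp_le_exp.mpr hΔ) (hc0 _))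

end History

/-! ## §3 The canonical weight family, and the budget -/

section Canonical

variable (F : T3Family) {K Ts : ℕ} (hTs : Ts ≤ K)
  (χ : (i : ℕ) → GaugeField (F.P i) 0 ↥(Matrix.specialUnitaryGroup (Fin 2) ℂ) → ℝ)

/-- **THE CANONICAL READING OF THE CUT WEIGHTS ON RUN `K`**: `w i U := ofReal (χ_{i+1} (descendTo_{i+1} U))` when `i + 1 ≤ K`, else `1` — measurable, `≤ 1` for `χ ≤ 1`, and
agreeing with the cut weights on every cut step `i < Ts ≤ K` (so §2's `hwm`, `hw1`, `hw` are met by this family). [cite: Balaban1985UV3, (7) p.257] -/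
theorem canonicalWeight_spec (hχm : ∀ i, Measurable (χ i)) (hχ1 : ∀ i U, χ i U ≤ 1) :
    (∀ i, Measurable fun U : GaugeField (F.P K) 0 ↥(Matrix.specialUnitaryGroup (Fin 2) ℂ) =>
        if h : i + 1 ≤ K then ENNReal.ofReal (χ (i + 1) (descendTo F ℰp (i + 1) K h U)) else 1) ∧
    (∀ i (U : GaugeField (F.P K) 0 ↥(Matrix.specialUnitaryGroup (Fin 2) ℂ)),
        (if h : i + 1 ≤ K then ENNReal.ofReal (χ (i + 1) (descendTo F ℰp (i + 1) K h U)) else 1) ≤ 1) ∧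
    (∀ (j i : ℕ), j ≤ i → ∀ (hiT : i < Ts), ∀ U : GaugeField (F.P K) 0 ↥(Matrix.specialUnitaryGroup (Fin 2) ℂ),
        (if h : i + 1 ≤ K then ENNReal.ofReal (χ (i + 1) (descendTo F ℰp (i + 1) K h U)) else 1) =
          ENNReal.ofReal (χ (i + 1) (descendTo F ℰp (i + 1) K (Nat.succ_le_of_lt (lt_of_lt_of_le hiT hTs)) U))) := by
  refine ⟨fun i => ?_, fun i U => ?_, fun j i _ hiT U => ?_⟩
  · by_cases h : i + 1 ≤ K
    · simp only [h, dif_pos]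
      exact ENNReal.measurable_ofReal.comp ((hχm (i + 1)).comp (measurable_descendTo F ℰp measurableE_ℰp h))
    · simp only [h, dif_neg, not_false_eq_true]
      exact measurable_const
  · by_cases h : i + 1 ≤ K
    · simp only [h, dif_pos]
      exact ENNReal.ofReal_le_one.mpr (hχ1 _ _)
    · simp only [h, dif_neg, not_false_eq_true, le_refl]
  · have h : i + 1 ≤ K := Nat.succ_le_of_lt (lt_of_lt_of_le hiT hTs)
    simp only [h, dif_pos]

end Canonical

end Summit.QuantumFields.YangMills.Theorems.FluctuationComparisonRegPrIntLS1aDomBGOfHistoryLetters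

end
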